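import Summits.FinalStateConjecture.FinalStateConjecture.Theorems.ClusterCompletenessOmegaLimitMultiKerrEternalFamilies
import Summits.FinalStateConjecture.FinalStateConjecture.Theorems.ClusterCompletenessOmegaLimitMultiKerrBarbalat
import Mathlib.MeasureTheory.Integral.IntegralEqImproper
import HarnessLib

/-!
# Route ClusterCompleteness · crux `OmegaLimitMultiKerr` — the INVARIANCE PRINCIPLE in the
# `Cᵏ_loc`-translate currency: Lyapunov functionals are constant on ω-limits and on all their
# time-translates; dissipation rates vanish there identically (LaSalle; Barbalat)

Structure lemmas for the crux stmt-FinalStateConjecture-14664 (`ClusterCompleteness.OmegaLimitMultiKerr`,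
rank 9), line `Sketch`, lead gen 5, registered stub `lyapunov_omegaLimit_translate_eq` (closed form).

The LaSalle reading of the crux (idea cards `lasalle-lands-on-liminf`, `long-coarse-windows-…`;
leads 0–c4, `Cruxes/OmegaLimitMultiKerr/Lines/Sketch.md`) is: the late-time translates
`x ↦ h (x + t • e)` of the charted geometry `h` of a TAME development have `Cᵏ_loc` ω-limits
(`…TranslateCompactness`, `…BackgroundOmegaLimits`), these come in eternal families
(`…EternalFamilies`: the ω-limit along `T n + s` is the `s`-translate of the ω-limit along `T n`),
and the monotone quantities of general relativity (Bondi mass, horizon area; their dissipation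
rates: news flux, shear flux) should force every ω-limit to be NON-RADIATING AT EVERY TIME — the
"dark-limit dictionary" feeding stationary-vacuum rigidity. This file proves the abstract step of
that dictionary, i.e. LaSalle's invariance principle (LaSalle 1960; Hale 1980, Ch. X, §1,
Thm. 1.3: "the ω-limit set of a bounded orbit lies in the largest invariant subset of `{V̇ = 0}`")
for the translation flow and the `supCkENorm`-on-compacts convergence, with the functional's
continuity asked ONLY along the orbit (sequentially, for translates converging to a field on
compacts of the domain `O`) — the minimal hypothesis, and the only one a flux through a compact
piece of a chart can be expected to satisfy:

* `tendsto_atTop_ciInf_of_antitoneOn` — a quantity antitone and bounded below on a half-line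
  converges (`V(t) → inf V`): the form in which "the Bondi mass is non-increasing and bounded below
  by the final mass" enters.
* `lyapunov_omegaLimit_translate_eq` (registered stub) — **invariance principle, equality form**:
  if `V (h (· + t • e)) → L` as `t → +∞` and `V` is sequentially continuous along the orbit, then
  `V (g (· + s • e)) = L` for EVERY ω-limit `g` of `h` and EVERY `s ∈ ℝ` (values in any Hausdorff
  space: vector-valued charges, pairs (mass, angular momentum), … are allowed).
* `lyapunov_omegaLimit_translate_le` — **lower-semicontinuous form**: if `V` is only sequentially
  LOWER semicontinuous along the orbit (energies may drop in a local limit — radiation escaping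
  through the ends of the slab), then `V (g (· + s • e)) ≤ L` for every ω-limit and every `s`.
* `flux_omegaLimit_translate_eq_zero_of_integrableOn` — **Barbalat form**: a flux
  `t ↦ Φ (h (· + t • e))` uniformly continuous and integrable on a half-line (finite radiated
  budget; uniform continuity = tameness in time) vanishes on every translate of every ω-limit
  (`barbalat_tendsto_zero`, landed p122681, + the equality form with `L = 0`).
* `flux_omegaLimit_translate_eq_zero_of_hasDerivAt` — **dissipation form** (LaSalle proper): if
  `d/dt V (h (· + t • e)) = -Φ (h (· + t • e))` with `Φ ≥ 0` along the orbit, `V` convergent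
  (e.g. bounded below) and the dissipation rate uniformly continuous in `t`, then `Φ` vanishes on
  every translate of every ω-limit (the budget `∫ Φ = V(a) − L < ∞` is automatic:
  `MeasureTheory.integrableOn_Ioi_deriv_of_nonneg'`).
* `flux_translate_eq_zero_of_forall_eq_of_hasDerivAt` — **second route, no tameness in time**:
  once `s ↦ V (g (· + s • e))` is CONSTANT (equality form) and the limit object obeys the same
  dissipation identity `d/ds V (g (· + s • e)) = -Φ (g (· + s • e))` (in GR: the ω-limit is again a
  vacuum development with a Bondi mass-loss formula), `Φ (g (· + s • e)) = 0` for every `s` — the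
  textbook LaSalle argument (Hale 1980, Ch. X, §1, proof of Thm. 1.3).

Everything is proved; Mathlib + the landed `…EternalFamilies` / `…Barbalat` files only; no
definitions (the ω-limit relation is spelled out as the hypothesis
`∀ K ⊆ O, IsCompact K → supCkENorm K k (h (· + T n • e) − g) → 0`, `T n → +∞`, exactly as produced by
`exists_strictMono_tendsto_supCkENorm_translate_sub` and consumed by `…HoleOmegaLimits`).

## References
* J. P. LaSalle, *Some extensions of Liapunov's second method*, IRE Trans. Circuit Theory 7 (1960)
  520–527 (the invariance principle).
* J. K. Hale, *Ordinary Differential Equations*, 2nd ed., Krieger 1980, Ch. I §8 (ω-limit sets),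
  Ch. X §1 (LaSalle's invariance principle). [Hale1980]
* I. Barbalat, Rev. Math. Pures Appl. 4 (1959) 267–270 (Barbalat's lemma; landed `…Barbalat`).
-/

-- every `Summit.FinalStateConjecture.FinalStateConjecture.…` name repeats the summit = sub-problem segment (D-0017 layout)
set_option linter.dupNamespace false

noncomputable section

open Set Filter Topology Function
open scoped ContDiff Topology ENNReal

namespace Summit.FinalStateConjecture.FinalStateConjecture.Theorems.ClusterCompleteness

open Literature.Geometry.Lorentzian MeasureTheory

/-! ### Monotone bounded quantities converge -/

/-- **A quantity antitone and bounded below on a half-line converges** (to its infimum over the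
half-line): the form in which a non-increasing, bounded-below Lyapunov quantity (Bondi mass,
`-`(horizon area)) enters the invariance principle. Monotone convergence; Hale 1980, Ch. X, §1.
[cite: Hale1980, Ch. X §1] -/
theorem tendsto_atTop_ciInf_of_antitoneOn {F : ℝ → ℝ} {a : ℝ} (ha : AntitoneOn F (Ici a))
    (hb : BddBelow (F '' Ici a)) : Tendsto F atTop (𝓝 (⨅ t : Ici a, F t)) := by
  have h1 : Antitone fun t : Ici a ↦ F t := fun s t hst ↦ ha s.2 t.2 hst
  have h2 : BddBelow (range fun t : Ici a ↦ F t) := by rwa [← image_eq_range]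
  exact tendsto_comp_val_Ici_atTop.1 (tendsto_atTop_ciInf h1 h2)

/-- Existential reading of `tendsto_atTop_ciInf_of_antitoneOn`: an antitone bounded-below quantity
on a half-line has a limit at `+∞`. [cite: Hale1980, Ch. X §1] -/
theorem exists_tendsto_of_antitoneOn_of_bddBelow {F : ℝ → ℝ} {a : ℝ} (ha : AntitoneOn F (Ici a))
    (hb : BddBelow (F '' Ici a)) : ∃ L : ℝ, Tendsto F atTop (𝓝 L) :=
  ⟨_, tendsto_atTop_ciInf_of_antitoneOn ha hb⟩

/-! ### The invariance principle: Lyapunov functionals are constant on ω-limits -/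

/-- **LaSalle's invariance principle in the `Cᵏ_loc`-translate currency, equality form**
(registered structure stub of line `Sketch`, crux stmt-FinalStateConjecture-14664; closed form).
Let `O` be invariant under all translations `x ↦ x + s • e`, let `h : E → W` be the orbit's field
and `V` a functional with values in a Hausdorff space such that (i) `V (h (· + t • e)) → L` as
`t → +∞` (e.g. `V` antitone and bounded below along the orbit, `tendsto_atTop_ciInf_of_antitoneOn`),
and (ii) `V` is sequentially continuous ALONG THE ORBIT: whenever translates `h (· + tₙ • e)`,
`tₙ → +∞`, converge to a field `g'` in `supCkENorm K k` on every compact `K ⊆ O`, then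
`V (h (· + tₙ • e)) → V g'`. Then `V` takes the value `L` on every ω-limit `g` of `h` (limit of
the translates along some `Tₙ → +∞`) AND ON ALL ITS TIME-TRANSLATES `g (· + s • e)`, `s ∈ ℝ`:
the ω-limit along `Tₙ + s` is the `s`-translate of the ω-limit along `Tₙ`
(`tendsto_supCkENorm_translate_add_shift`), and limits in a Hausdorff space are unique.
LaSalle 1960; Hale 1980, Ch. X, §1, Thm. 1.3 (`V` is constant on `ω(γ)`, which is invariant).
[cite: Hale1980, Ch. X §1] -/
theorem lyapunov_omegaLimit_translate_eq :
    ∀ {E : Type*} [NormedAddCommGroup E] [NormedSpace ℝ E]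
      {W : Type*} [NormedAddCommGroup W] [NormedSpace ℝ W]
      {β : Type*} [TopologicalSpace β] [T2Space β]
      {O : Set E} {e : E}, (∀ x ∈ O, ∀ s : ℝ, x + s • e ∈ O) →
      ∀ {k : ℕ} {h : E → W} (V : (E → W) → β) {L : β},
      Tendsto (fun t : ℝ ↦ V (fun x ↦ h (x + t • e))) atTop (𝓝 L) →
      (∀ (t : ℕ → ℝ) (g' : E → W), Tendsto t atTop atTop →
        (∀ K ⊆ O, IsCompact K →
          Tendsto (fun n ↦ supCkENorm K k (fun x ↦ h (x + t n • e) - g' x)) atTop (𝓝 0)) →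
        Tendsto (fun n ↦ V (fun x ↦ h (x + t n • e))) atTop (𝓝 (V g'))) →
      ∀ {g : E → W} {T : ℕ → ℝ}, Tendsto T atTop atTop →
      (∀ K ⊆ O, IsCompact K →
        Tendsto (fun n ↦ supCkENorm K k (fun x ↦ h (x + T n • e) - g x)) atTop (𝓝 0)) →
      ∀ s : ℝ, V (fun x ↦ g (x + s • e)) = L := by
  intro E _ _ W _ _ β _ _ O e hO k h V L hL hV g T hT hlim s
  -- the ω-limit along the shifted times `T n + s` is the `s`-translate of `g`
  have h1 := tendsto_supCkENorm_translate_add_shift hO hlim s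
  have h2 : Tendsto (fun n ↦ T n + s) atTop atTop := tendsto_atTop_add_const_right _ _ hT
  have h3 : Tendsto (fun n ↦ V (fun x ↦ h (x + (T n + s) • e))) atTop
      (𝓝 (V fun x ↦ g (x + s • e))) :=
    hV (fun n ↦ T n + s) (fun x ↦ g (x + s • e)) h2 h1
  have h4 : Tendsto (fun n ↦ V (fun x ↦ h (x + (T n + s) • e))) atTop (𝓝 L) := hL.comp h2
  exact tendsto_nhds_unique h3 h4

/-- **Invariance principle, lower-semicontinuous form.** Same setting, real-valued `V` with
`V (h (· + t • e)) → L`, but `V` only sequentially LOWER semicontinuous along the orbit: whenever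
translates `h (· + tₙ • e)`, `tₙ → +∞`, converge to `g'` on compacts of `O`, every `b < V g'`
eventually satisfies `b < V (h (· + tₙ • e))` (the behaviour of energies under local convergence,
where mass may escape through the ends of the slab). Then `V (g (· + s • e)) ≤ L` for every
ω-limit `g` of `h` and every `s ∈ ℝ`. Hale 1980, Ch. X, §1. [cite: Hale1980, Ch. X §1] -/
theorem lyapunov_omegaLimit_translate_le :
    ∀ {E : Type*} [NormedAddCommGroup E] [NormedSpace ℝ E]
      {W : Type*} [NormedAddCommGroup W] [NormedSpace ℝ W]
      {O : Set E} {e : E}, (∀ x ∈ O, ∀ s : ℝ, x + s • e ∈ O) →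
      ∀ {k : ℕ} {h : E → W} (V : (E → W) → ℝ) {L : ℝ},
      Tendsto (fun t : ℝ ↦ V (fun x ↦ h (x + t • e))) atTop (𝓝 L) →
      (∀ (t : ℕ → ℝ) (g' : E → W), Tendsto t atTop atTop →
        (∀ K ⊆ O, IsCompact K →
          Tendsto (fun n ↦ supCkENorm K k (fun x ↦ h (x + t n • e) - g' x)) atTop (𝓝 0)) →
        ∀ b < V g', ∀ᶠ n in atTop, b < V (fun x ↦ h (x + t n • e))) →
      ∀ {g : E → W} {T : ℕ → ℝ}, Tendsto T atTop atTop →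
      (∀ K ⊆ O, IsCompact K →
        Tendsto (fun n ↦ supCkENorm K k (fun x ↦ h (x + T n • e) - g x)) atTop (𝓝 0)) →
      ∀ s : ℝ, V (fun x ↦ g (x + s • e)) ≤ L := by
  intro E _ _ W _ _ O e hO k h V L hL hV g T hT hlim s
  by_contra! hlt
  obtain ⟨b, hLb, hbV⟩ := exists_between hlt
  have h1 := tendsto_supCkENorm_translate_add_shift hO hlim s
  have h2 : Tendsto (fun n ↦ T n + s) atTop atTop := tendsto_atTop_add_const_right _ _ hT
  have h3 : ∀ᶠ n in atTop, b < V (fun x ↦ h (x + (T n + s) • e)) :=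
    hV (fun n ↦ T n + s) (fun x ↦ g (x + s • e)) h2 h1 b hbV
  have h4 : ∀ᶠ n in atTop, V (fun x ↦ h (x + (T n + s) • e)) < b :=
    (hL.comp h2).eventually (gt_mem_nhds hLb)
  obtain ⟨n, hn, hn'⟩ := (h3.and h4).exists
  exact lt_irrefl _ (hn.trans hn')

/-! ### Dissipation rates vanish identically on ω-limits -/

/-- **Barbalat form: an integrable, uniformly continuous flux vanishes on every translate of every
ω-limit.** Same setting; `Φ` a real functional, sequentially continuous along the orbit, whose
values along the orbit `t ↦ Φ (h (· + t • e))` are uniformly continuous (tameness in time) and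
integrable (finite radiated budget) on a half-line `[a, ∞)`. Then `Φ (g (· + s • e)) = 0` for
every ω-limit `g` of `h` and every `s ∈ ℝ`: Barbalat's lemma (`barbalat_tendsto_zero`) gives
`Φ (h (· + t • e)) → 0`, and the equality form of the invariance principle applies with `L = 0`.
Hale 1980, Ch. X, §1; Barbalat 1959. [cite: Hale1980, Ch. X §1] -/
theorem flux_omegaLimit_translate_eq_zero_of_integrableOn :
    ∀ {E : Type*} [NormedAddCommGroup E] [NormedSpace ℝ E]
      {W : Type*} [NormedAddCommGroup W] [NormedSpace ℝ W]
      {O : Set E} {e : E}, (∀ x ∈ O, ∀ s : ℝ, x + s • e ∈ O) →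
      ∀ {k : ℕ} {h : E → W} (Φ : (E → W) → ℝ) {a : ℝ},
      UniformContinuousOn (fun t : ℝ ↦ Φ (fun x ↦ h (x + t • e))) (Ici a) →
      IntegrableOn (fun t : ℝ ↦ Φ (fun x ↦ h (x + t • e))) (Ici a) →
      (∀ (t : ℕ → ℝ) (g' : E → W), Tendsto t atTop atTop →
        (∀ K ⊆ O, IsCompact K →
          Tendsto (fun n ↦ supCkENorm K k (fun x ↦ h (x + t n • e) - g' x)) atTop (𝓝 0)) →
        Tendsto (fun n ↦ Φ (fun x ↦ h (x + t n • e))) atTop (𝓝 (Φ g'))) →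
      ∀ {g : E → W} {T : ℕ → ℝ}, Tendsto T atTop atTop →
      (∀ K ⊆ O, IsCompact K →
        Tendsto (fun n ↦ supCkENorm K k (fun x ↦ h (x + T n • e) - g x)) atTop (𝓝 0)) →
      ∀ s : ℝ, Φ (fun x ↦ g (x + s • e)) = 0 := by
  intro E _ _ W _ _ O e hO k h Φ a hu hi hΦ g T hT hlim s
  exact lyapunov_omegaLimit_translate_eq hO Φ (barbalat_tendsto_zero hu hi) hΦ hT hlim s

/-- **Dissipation form (LaSalle proper): the dissipation rate of a convergent Lyapunov quantity
vanishes on every translate of every ω-limit.** Same setting; `V`, `Φ` real functionals with the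
DISSIPATION IDENTITY `d/dt V (h (· + t • e)) = -Φ (h (· + t • e))` on `[a, ∞)`, `Φ ≥ 0` along the
orbit after time `a`, `V (h (· + t • e)) → L` (e.g. `V` bounded below), the rate
`t ↦ Φ (h (· + t • e))` uniformly continuous on `[a, ∞)` and `Φ` sequentially continuous along
the orbit. Then `Φ (g (· + s • e)) = 0` for every ω-limit `g` of `h` and every `s ∈ ℝ`: the
budget `∫_a^∞ Φ = V(a) − L` is finite (`MeasureTheory.integrableOn_Ioi_deriv_of_nonneg'`), so the
Barbalat form applies. LaSalle 1960; Hale 1980, Ch. X, §1, Thm. 1.3 (ω-limit sets lie in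
`{V̇ = 0}`). [cite: Hale1980, Ch. X §1] -/
theorem flux_omegaLimit_translate_eq_zero_of_hasDerivAt :
    ∀ {E : Type*} [NormedAddCommGroup E] [NormedSpace ℝ E]
      {W : Type*} [NormedAddCommGroup W] [NormedSpace ℝ W]
      {O : Set E} {e : E}, (∀ x ∈ O, ∀ s : ℝ, x + s • e ∈ O) →
      ∀ {k : ℕ} {h : E → W} (V Φ : (E → W) → ℝ) {a L : ℝ},
      (∀ t ∈ Ici a, HasDerivAt (fun τ : ℝ ↦ V (fun x ↦ h (x + τ • e)))
        (-Φ (fun x ↦ h (x + t • e))) t) →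
      (∀ t ∈ Ioi a, 0 ≤ Φ (fun x ↦ h (x + t • e))) →
      Tendsto (fun t : ℝ ↦ V (fun x ↦ h (x + t • e))) atTop (𝓝 L) →
      UniformContinuousOn (fun t : ℝ ↦ Φ (fun x ↦ h (x + t • e))) (Ici a) →
      (∀ (t : ℕ → ℝ) (g' : E → W), Tendsto t atTop atTop →
        (∀ K ⊆ O, IsCompact K →
          Tendsto (fun n ↦ supCkENorm K k (fun x ↦ h (x + t n • e) - g' x)) atTop (𝓝 0)) →
        Tendsto (fun n ↦ Φ (fun x ↦ h (x + t n • e))) atTop (𝓝 (Φ g'))) →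
      ∀ {g : E → W} {T : ℕ → ℝ}, Tendsto T atTop atTop →
      (∀ K ⊆ O, IsCompact K →
        Tendsto (fun n ↦ supCkENorm K k (fun x ↦ h (x + T n • e) - g x)) atTop (𝓝 0)) →
      ∀ s : ℝ, Φ (fun x ↦ g (x + s • e)) = 0 := by
  intro E _ _ W _ _ O e hO k h V Φ a L hder hpos hL hu hΦ g T hT hlim s
  -- the budget is finite: `Φ ∘ orbit` is integrable on `[a, ∞)`
  have hi : IntegrableOn (fun t : ℝ ↦ Φ (fun x ↦ h (x + t • e))) (Ici a) := by
    have hneg : IntegrableOn (fun t : ℝ ↦ -Φ (fun x ↦ h (x + t • e))) (Ioi a) :=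
      integrableOn_Ioi_deriv_of_nonpos' hder (fun t ht ↦ neg_nonpos.2 (hpos t ht)) hL
    have hIoi : IntegrableOn (fun t : ℝ ↦ Φ (fun x ↦ h (x + t • e))) (Ioi a) := by
      simpa only [Pi.neg_def, neg_neg] using hneg.neg
    exact (integrableOn_Ici_iff_integrableOn_Ioi enorm_ne_top).2 hIoi
  exact flux_omegaLimit_translate_eq_zero_of_integrableOn hO Φ hu hi hΦ hT hlim s

/-- **Second route, no tameness in time: a dissipation identity ON THE LIMIT forces zero
dissipation.** If `s ↦ V (g (· + s • e))` is constant (the conclusion of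
`lyapunov_omegaLimit_translate_eq` for an ω-limit `g`) and the limit object obeys the dissipation
identity `d/ds V (g (· + s • e)) = -Φ (g (· + s • e))` at `s₀`, then `Φ (g (· + s₀ • e)) = 0`
(a constant function has derivative `0`; derivatives are unique). This is the textbook proof of
LaSalle's theorem (Hale 1980, Ch. X, §1, proof of Thm. 1.3), usable when the dissipation identity is
known for the ω-limit itself (in general relativity: the limit is again a vacuum development with
a mass-loss formula) rather than uniform continuity of the rate along the orbit.
[cite: Hale1980, Ch. X §1] -/
theorem flux_translate_eq_zero_of_forall_eq_of_hasDerivAt {E : Type*} [AddCommGroup E]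
    [Module ℝ E] {W : Type*} {e : E} {g : E → W} (V Φ : (E → W) → ℝ) {L : ℝ}
    (hconst : ∀ s : ℝ, V (fun x ↦ g (x + s • e)) = L) {s₀ : ℝ}
    (hder : HasDerivAt (fun s : ℝ ↦ V (fun x ↦ g (x + s • e))) (-Φ (fun x ↦ g (x + s₀ • e))) s₀) :
    Φ (fun x ↦ g (x + s₀ • e)) = 0 := by
  have hc : HasDerivAt (fun s : ℝ ↦ V (fun x ↦ g (x + s • e))) 0 s₀ := by
    have : (fun s : ℝ ↦ V (fun x ↦ g (x + s • e))) = fun _ ↦ L := funext hconst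
    rw [this]
    exact hasDerivAt_const s₀ L
  have h := hder.unique hc
  linarith

end Summit.FinalStateConjecture.FinalStateConjecture.Theorems.ClusterCompleteness

end
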